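import Mathlib
import HarnessLib
import Summits.Ventures.LatticeQCDFlow.Exactness.SU2WilsonFlowLOMember

/-!
# Any masked `SU(2)` kick layer driven by a frozen local field is a certified coupling layer: FT-HMC through it is exact and reversible

HONEST FRAMING: exact (Metropolis-corrected) sampling algorithms for lattice gauge theory;
figures of merit are autocorrelation/cost numbers at stated couplings and volumes; no
continuum-physics claim.

Venture `LatticeQCDFlow` (cell pub-lqcd), topic `Exactness`; FANOUT row 14 (`eng-flowhmc`, engine
`latflow.fthmc`, family B = field-transformation HMC with a map `F`).  NEW WORK of the cell;
nothing is cited as a fact; no number.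

`SU2WilsonFlowLOSubstep.lean` certified ONE field on the `SU(2)` rung: the conjugate staple sum
of the leading-order Wilson flow.  The engine's other `SU(2)` members (the LEARNED residual
layers `maps.resid_substep_flat`: `U ↦ exp(−P(U R_w)) U` with a WEIGHTED frozen staple sum
`R_w`, coefficients produced by a network reading frozen loops only) have the same algebraic
shape with a different local field.  This file abstracts the field: for

* any finite link set `ι`, any active predicate `p` (the mask),
* any local field `J : (ι → SU(2)) → ι → ℝ⁴` that is measurable and FROZEN — at an active link
  its value does not change when only active links change —
* and the refusal rule `|ε| ‖J V i‖ < 1` at every active link,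

the masked update `V i ↦ gaussUnit (geodesicKick ε (J V i) (vecQuat (V i)))` (active `i`),
`V i ↦ V i` (frozen `i`) is a certified coupling layer:

* **`su2MaskedKick_certified`** — measurable, BIJECTIVE, `HasJacobian (⊗_i haarProbability SU(2))`
  with the product of the repaired per-link densities of `SU2KickPositiveJacobian.lean`, positive
  and measurable (`Theory2.hasJacobian_coupleFun` + `hasJacobian_su2Kick_fix` +
  `bijective_maskedLayer`);
* **`exists_measurableEquiv_su2MaskedKick`** — hence a measurable EQUIVALENCE (Souslin);
* on the gauge field `GaugeConfig d L SU(2)` with the engine's concrete update (Gaussian momenta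
  `(Edge × Fin 3) → ℝ`, the closed-form quaternion exponential drift, ANY measurable force, any
  trajectory length, flip, Metropolis on the pulled-back Hamiltonian, report through the layer):
  **`su2_fthmc_leapfrog_gaussian_exact_maskedKick`** (invariance of `e^{−S}·⊗Haar`),
  **`su2_fthmc_leapfrog_gaussian_isReversible_maskedKick`** (detailed balance).

The sequel `SU2MaskedKickSchedule.lean` adds `⟨e^{−ΔH̃}⟩ = 1` in equilibrium and SCHEDULES of such
layers (lists of masks / fields / step constants ⇒ lists of certified layers with the running
log-det, consumed by `hasJacobian_foldr_trans` exactly as the LO member is).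

The LO sub-step of `SU2WilsonFlowLOSubstep.lean` is the instance `J = conjugate staple sum`,
`p = (direction μ, colour class b)`; the learned residual layers are the instance of
`SU2ResidualLayer.lean`.

NOT CLAIMED: anything about which fields `J` a network produces (only measurability, frozenness
and the refusal rule are used); `SU(N ≥ 3)`; ergodicity; any number.
-/

noncomputable section

namespace Summit.Ventures.LatticeQCDFlow.Exactness

open Real Set MeasureTheory Measure InnerProductGeometry Metric WithLp
open Literature.MathematicalPhysics.QuantumFieldTheory Summit.Ventures.LatticeQCDFlow.Theory2
open ProbabilityTheory ProbabilityTheory.Kernel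
open scoped ENNReal Matrix

/-! ## The abstract masked kick layer is certified -/

section Certified

variable {ι : Type*} [Fintype ι] (p : ι → Prop) [DecidablePred p]

/-- **A masked `SU(2)` kick layer driven by a frozen, measurable local field inside the refusal
rule is a certified coupling layer.**  Links `ι → SU(2)`, active predicate `p`, field `J`
(measurable at every active link; frozen: `J V i = J W i` at active `i` whenever `V`, `W` agree on
the frozen links), step constant `ε` with `|ε| ‖J V i‖ < 1` at active links.  The layer is
measurable and bijective and has `HasJacobian (⊗_i haarProbability SU(2)) _ (∏_active j̃_i)` with
the repaired per-link densities `j̃_i(V) = kickJac (ε‖J V i‖) 2 (angle (J V i) (vecQuat (V i)))`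
(value `(1 − ε‖J V i‖ cos θ)³` at the poles), positive and measurable. -/
theorem su2MaskedKick_certified {ε : ℝ}
    (J : (ι → Matrix.specialUnitaryGroup (Fin 2) ℂ) → ι → R4)
    (hJm : ∀ i, p i → Measurable fun V : ι → Matrix.specialUnitaryGroup (Fin 2) ℂ => J V i)
    (hJloc : ∀ V W : ι → Matrix.specialUnitaryGroup (Fin 2) ℂ,
      (∀ j, ¬p j → V j = W j) → ∀ i, p i → J V i = J W i)
    (hκ : ∀ (V : ι → Matrix.specialUnitaryGroup (Fin 2) ℂ) (i : ι), p i → |ε| * ‖J V i‖ < 1) :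
    Measurable (fun (V : ι → Matrix.specialUnitaryGroup (Fin 2) ℂ) (i : ι) =>
        if p i then gaussUnit (geodesicKick ε (J V i)
          (vecQuat ((V i : Matrix.specialUnitaryGroup (Fin 2) ℂ) : Matrix (Fin 2) (Fin 2) ℂ)))
        else V i) ∧
    Function.Bijective (fun (V : ι → Matrix.specialUnitaryGroup (Fin 2) ℂ) (i : ι) =>
        if p i then gaussUnit (geodesicKick ε (J V i)
          (vecQuat ((V i : Matrix.specialUnitaryGroup (Fin 2) ℂ) : Matrix (Fin 2) (Fin 2) ℂ)))
        else V i) ∧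
    HasJacobian (Measure.pi fun _ : ι => haarProbability (Matrix.specialUnitaryGroup (Fin 2) ℂ))
      (fun (V : ι → Matrix.specialUnitaryGroup (Fin 2) ℂ) (i : ι) =>
        if p i then gaussUnit (geodesicKick ε (J V i)
          (vecQuat ((V i : Matrix.specialUnitaryGroup (Fin 2) ℂ) : Matrix (Fin 2) (Fin 2) ℂ)))
        else V i)
      (fun V => ENNReal.ofReal (∏ a : {i // p i},
        (if Real.sin (angle (J V a.1) (vecQuat ((V a.1 : Matrix.specialUnitaryGroup (Fin 2) ℂ) : Matrix (Fin 2) (Fin 2) ℂ))) = 0 then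
            (1 - ε * ‖J V a.1‖ * Real.cos (angle (J V a.1) (vecQuat ((V a.1 : Matrix.specialUnitaryGroup (Fin 2) ℂ) : Matrix (Fin 2) (Fin 2) ℂ)))) ^ 3
          else kickJac (ε * ‖J V a.1‖) 2 (angle (J V a.1) (vecQuat ((V a.1 : Matrix.specialUnitaryGroup (Fin 2) ℂ) : Matrix (Fin 2) (Fin 2) ℂ)))))) ∧
    (∀ V : ι → Matrix.specialUnitaryGroup (Fin 2) ℂ, 0 < ∏ a : {i // p i},
        (if Real.sin (angle (J V a.1) (vecQuat ((V a.1 : Matrix.specialUnitaryGroup (Fin 2) ℂ) : Matrix (Fin 2) (Fin 2) ℂ))) = 0 then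
            (1 - ε * ‖J V a.1‖ * Real.cos (angle (J V a.1) (vecQuat ((V a.1 : Matrix.specialUnitaryGroup (Fin 2) ℂ) : Matrix (Fin 2) (Fin 2) ℂ)))) ^ 3
          else kickJac (ε * ‖J V a.1‖) 2 (angle (J V a.1) (vecQuat ((V a.1 : Matrix.specialUnitaryGroup (Fin 2) ℂ) : Matrix (Fin 2) (Fin 2) ℂ))))) ∧
    Measurable fun V : ι → Matrix.specialUnitaryGroup (Fin 2) ℂ => ∏ a : {i // p i},
        (if Real.sin (angle (J V a.1) (vecQuat ((V a.1 : Matrix.specialUnitaryGroup (Fin 2) ℂ) : Matrix (Fin 2) (Fin 2) ℂ))) = 0 then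
            (1 - ε * ‖J V a.1‖ * Real.cos (angle (J V a.1) (vecQuat ((V a.1 : Matrix.specialUnitaryGroup (Fin 2) ℂ) : Matrix (Fin 2) (Fin 2) ℂ)))) ^ 3
          else kickJac (ε * ‖J V a.1‖) 2 (angle (J V a.1) (vecQuat ((V a.1 : Matrix.specialUnitaryGroup (Fin 2) ℂ) : Matrix (Fin 2) (Fin 2) ℂ)))) := by
  classical
  -- proof-local abbreviations: the frozen extension, the single-link maps and densities
  set EXT : {i // p i} → ({i // ¬p i} → Matrix.specialUnitaryGroup (Fin 2) ℂ) →
      Matrix.specialUnitaryGroup (Fin 2) ℂ → (ι → Matrix.specialUnitaryGroup (Fin 2) ℂ) :=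
    fun a y g j => if h : p j then (if j = a.1 then g else 1) else y ⟨j, h⟩ with hEXT
  set ψ : {i // p i} → ({i // ¬p i} → Matrix.specialUnitaryGroup (Fin 2) ℂ) →
      Matrix.specialUnitaryGroup (Fin 2) ℂ → Matrix.specialUnitaryGroup (Fin 2) ℂ :=
    fun a y g => gaussUnit (geodesicKick ε (J (EXT a y 1) a.1)
      (vecQuat ((g : Matrix.specialUnitaryGroup (Fin 2) ℂ) : Matrix (Fin 2) (Fin 2) ℂ))) with hψ
  set jac : {i // p i} → ({i // ¬p i} → Matrix.specialUnitaryGroup (Fin 2) ℂ) →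
      Matrix.specialUnitaryGroup (Fin 2) ℂ → ℝ :=
    fun a y g =>
      if Real.sin (angle (J (EXT a y 1) a.1) (vecQuat ((g : Matrix.specialUnitaryGroup (Fin 2) ℂ) : Matrix (Fin 2) (Fin 2) ℂ))) = 0 then
        (1 - ε * ‖J (EXT a y 1) a.1‖ *
          Real.cos (angle (J (EXT a y 1) a.1) (vecQuat ((g : Matrix.specialUnitaryGroup (Fin 2) ℂ) : Matrix (Fin 2) (Fin 2) ℂ)))) ^ 3
      else kickJac (ε * ‖J (EXT a y 1) a.1‖) 2
        (angle (J (EXT a y 1) a.1) (vecQuat ((g : Matrix.specialUnitaryGroup (Fin 2) ℂ) : Matrix (Fin 2) (Fin 2) ℂ))) with hjac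
  -- the field at an active link does not read the active links
  have hJloc' : ∀ (a : {i // p i}) (V : ι → Matrix.specialUnitaryGroup (Fin 2) ℂ),
      J (EXT a (fun f => V f) 1) a.1 = J V a.1 := fun a V =>
    hJloc _ _ (fun j hj => by
      simp only [hEXT]
      rw [dif_neg hj]) a.1 a.2
  have hκ' : ∀ (W : ι → Matrix.specialUnitaryGroup (Fin 2) ℂ) (a : {i // p i}), |ε| * ‖J W a.1‖ < 1 :=
    fun W a => hκ W a.1 a.2
  -- measurability of the frozen extension and of the transported field
  have hEXTm : ∀ a : {i // p i},
      Measurable fun y : {i // ¬p i} → Matrix.specialUnitaryGroup (Fin 2) ℂ => EXT a y 1 := by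
    intro a
    refine measurable_pi_lambda _ fun j => ?_
    by_cases hj : p j
    · simp only [hEXT, dif_pos hj]
      exact measurable_const
    · simp only [hEXT, dif_neg hj]
      exact measurable_pi_apply _
  have hJSm : ∀ a : {i // p i},
      Measurable fun q : Matrix.specialUnitaryGroup (Fin 2) ℂ × ({i // ¬p i} → Matrix.specialUnitaryGroup (Fin 2) ℂ) =>
        J (EXT a q.2 1) a.1 :=
    fun a => ((hJm a.1 a.2).comp (hEXTm a)).comp measurable_snd
  -- the coupling layer IS the masked kick layer
  have hcf : coupleFun p ψ =
      fun (V : ι → Matrix.specialUnitaryGroup (Fin 2) ℂ) (i : ι) =>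
        if p i then gaussUnit (geodesicKick ε (J V i)
          (vecQuat ((V i : Matrix.specialUnitaryGroup (Fin 2) ℂ) : Matrix (Fin 2) (Fin 2) ℂ)))
        else V i := by
    funext V i
    by_cases hi : p i
    · rw [coupleFun_apply_of_pos ψ V hi, if_pos hi]
      simp only [hψ]
      rw [hJloc' ⟨i, hi⟩ V]
    · rw [coupleFun_apply_of_neg ψ V hi, if_neg hi]
  -- per-link certificates
  have hJ1 : ∀ a y, HasJacobian (haarProbability (Matrix.specialUnitaryGroup (Fin 2) ℂ)) (ψ a y)
      fun g => ENNReal.ofReal (jac a y g) :=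
    fun a y => hasJacobian_su2Kick_fix (hκ' (EXT a y 1) a).le
  have hψm : ∀ a, Measurable fun q : Matrix.specialUnitaryGroup (Fin 2) ℂ × ({i // ¬p i} → Matrix.specialUnitaryGroup (Fin 2) ℂ) =>
      ψ a q.2 q.1 := by
    intro a
    have hfun : (fun q : Matrix.specialUnitaryGroup (Fin 2) ℂ × ({i // ¬p i} → Matrix.specialUnitaryGroup (Fin 2) ℂ) => ψ a q.2 q.1) =
        (fun r : Matrix.specialUnitaryGroup (Fin 2) ℂ × R4 =>
          gaussUnit (geodesicKick ε r.2 (vecQuat ((r.1 : Matrix.specialUnitaryGroup (Fin 2) ℂ) : Matrix (Fin 2) (Fin 2) ℂ)))) ∘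
          (fun q : Matrix.specialUnitaryGroup (Fin 2) ℂ × ({i // ¬p i} → Matrix.specialUnitaryGroup (Fin 2) ℂ) => (q.1, J (EXT a q.2 1) a.1)) := by
      funext q
      simp only [Function.comp_apply, hψ]
    rw [hfun]
    exact (measurable_su2Kick₂ ε).comp (measurable_fst.prodMk (hJSm a))
  have hjm : ∀ a, Measurable fun q : Matrix.specialUnitaryGroup (Fin 2) ℂ × ({i // ¬p i} → Matrix.specialUnitaryGroup (Fin 2) ℂ) =>
      jac a q.2 q.1 := by
    intro a
    have hfun : (fun q : Matrix.specialUnitaryGroup (Fin 2) ℂ × ({i // ¬p i} → Matrix.specialUnitaryGroup (Fin 2) ℂ) => jac a q.2 q.1) =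
        (fun r : Matrix.specialUnitaryGroup (Fin 2) ℂ × R4 =>
          (if Real.sin (angle r.2 (vecQuat ((r.1 : Matrix.specialUnitaryGroup (Fin 2) ℂ) : Matrix (Fin 2) (Fin 2) ℂ))) = 0 then
              (1 - ε * ‖r.2‖ * Real.cos (angle r.2 (vecQuat ((r.1 : Matrix.specialUnitaryGroup (Fin 2) ℂ) : Matrix (Fin 2) (Fin 2) ℂ)))) ^ 3
            else kickJac (ε * ‖r.2‖) 2 (angle r.2 (vecQuat ((r.1 : Matrix.specialUnitaryGroup (Fin 2) ℂ) : Matrix (Fin 2) (Fin 2) ℂ))))) ∘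
          (fun q : Matrix.specialUnitaryGroup (Fin 2) ℂ × ({i // ¬p i} → Matrix.specialUnitaryGroup (Fin 2) ℂ) => (q.1, J (EXT a q.2 1) a.1)) := by
      funext q
      simp only [Function.comp_apply, hjac]
    rw [hfun]
    exact (measurable_su2KickJacFix₂ ε).comp (measurable_fst.prodMk (hJSm a))
  have hj0 : ∀ a y g, 0 ≤ jac a y g := fun a y g => (su2KickJacFix_pos (hκ' (EXT a y 1) a) g).le
  have hHJ := hasJacobian_coupleFun (p := p)
    (haarProbability (Matrix.specialUnitaryGroup (Fin 2) ℂ)) hψm hjm hJ1 hj0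
  -- the layer Jacobian is the booked product
  have hcj : (fun U : ι → Matrix.specialUnitaryGroup (Fin 2) ℂ => ENNReal.ofReal (coupleJac p jac U)) =
      fun V => ENNReal.ofReal (∏ a : {i // p i},
        (if Real.sin (angle (J V a.1) (vecQuat ((V a.1 : Matrix.specialUnitaryGroup (Fin 2) ℂ) : Matrix (Fin 2) (Fin 2) ℂ))) = 0 then
            (1 - ε * ‖J V a.1‖ * Real.cos (angle (J V a.1) (vecQuat ((V a.1 : Matrix.specialUnitaryGroup (Fin 2) ℂ) : Matrix (Fin 2) (Fin 2) ℂ)))) ^ 3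
          else kickJac (ε * ‖J V a.1‖) 2 (angle (J V a.1) (vecQuat ((V a.1 : Matrix.specialUnitaryGroup (Fin 2) ℂ) : Matrix (Fin 2) (Fin 2) ℂ))))) := by
    funext V
    refine congrArg ENNReal.ofReal ?_
    unfold coupleJac
    refine Finset.prod_congr rfl fun a _ => ?_
    simp only [hjac]
    rw [hJloc' a V]
  have hJprod_meas : Measurable fun V : ι → Matrix.specialUnitaryGroup (Fin 2) ℂ => ∏ a : {i // p i},
        (if Real.sin (angle (J V a.1) (vecQuat ((V a.1 : Matrix.specialUnitaryGroup (Fin 2) ℂ) : Matrix (Fin 2) (Fin 2) ℂ))) = 0 then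
            (1 - ε * ‖J V a.1‖ * Real.cos (angle (J V a.1) (vecQuat ((V a.1 : Matrix.specialUnitaryGroup (Fin 2) ℂ) : Matrix (Fin 2) (Fin 2) ℂ)))) ^ 3
          else kickJac (ε * ‖J V a.1‖) 2 (angle (J V a.1) (vecQuat ((V a.1 : Matrix.specialUnitaryGroup (Fin 2) ℂ) : Matrix (Fin 2) (Fin 2) ℂ)))) := by
    refine Finset.measurable_prod _ fun a _ => ?_
    have h1 : Measurable fun V : ι → Matrix.specialUnitaryGroup (Fin 2) ℂ => (V a.1, J V a.1) :=
      (measurable_pi_apply _).prodMk (hJm a.1 a.2)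
    have hfun : (fun V : ι → Matrix.specialUnitaryGroup (Fin 2) ℂ =>
        (if Real.sin (angle (J V a.1) (vecQuat ((V a.1 : Matrix.specialUnitaryGroup (Fin 2) ℂ) : Matrix (Fin 2) (Fin 2) ℂ))) = 0 then
            (1 - ε * ‖J V a.1‖ * Real.cos (angle (J V a.1) (vecQuat ((V a.1 : Matrix.specialUnitaryGroup (Fin 2) ℂ) : Matrix (Fin 2) (Fin 2) ℂ)))) ^ 3
          else kickJac (ε * ‖J V a.1‖) 2 (angle (J V a.1) (vecQuat ((V a.1 : Matrix.specialUnitaryGroup (Fin 2) ℂ) : Matrix (Fin 2) (Fin 2) ℂ))))) =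
        (fun r : Matrix.specialUnitaryGroup (Fin 2) ℂ × R4 =>
          (if Real.sin (angle r.2 (vecQuat ((r.1 : Matrix.specialUnitaryGroup (Fin 2) ℂ) : Matrix (Fin 2) (Fin 2) ℂ))) = 0 then
              (1 - ε * ‖r.2‖ * Real.cos (angle r.2 (vecQuat ((r.1 : Matrix.specialUnitaryGroup (Fin 2) ℂ) : Matrix (Fin 2) (Fin 2) ℂ)))) ^ 3
            else kickJac (ε * ‖r.2‖) 2 (angle r.2 (vecQuat ((r.1 : Matrix.specialUnitaryGroup (Fin 2) ℂ) : Matrix (Fin 2) (Fin 2) ℂ))))) ∘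
          (fun V : ι → Matrix.specialUnitaryGroup (Fin 2) ℂ => (V a.1, J V a.1)) := by
      funext V
      simp only [Function.comp_apply]
    rw [hfun]
    exact (measurable_su2KickJacFix₂ ε).comp h1
  refine ⟨?_, ?_, ?_, ?_, hJprod_meas⟩
  · rw [← hcf]
    exact hHJ.measurable
  · rw [← hcf, coupleFun_eq_conj]
    exact (MeasurableEquiv.bijective _).comp ((bijective_maskedLayer (fun y a g => ψ a y g)
      fun y a => bijective_su2Kick (hκ' (EXT a y 1) a).le).comp (MeasurableEquiv.bijective _))
  · rw [← hcf, ← hcj]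
    exact hHJ
  · intro V
    exact Finset.prod_pos fun a _ => su2KickJacFix_pos (hκ' V a) (V a.1)

/-- **The masked kick layer is a measurable equivalence of `ι → SU(2)` with certified Jacobian**
(Souslin packaging of `su2MaskedKick_certified`; `SU(2)` is Polish). -/
theorem exists_measurableEquiv_su2MaskedKick [Countable ι] {ε : ℝ}
    (J : (ι → Matrix.specialUnitaryGroup (Fin 2) ℂ) → ι → R4)
    (hJm : ∀ i, p i → Measurable fun V : ι → Matrix.specialUnitaryGroup (Fin 2) ℂ => J V i)
    (hJloc : ∀ V W : ι → Matrix.specialUnitaryGroup (Fin 2) ℂ,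
      (∀ j, ¬p j → V j = W j) → ∀ i, p i → J V i = J W i)
    (hκ : ∀ (V : ι → Matrix.specialUnitaryGroup (Fin 2) ℂ) (i : ι), p i → |ε| * ‖J V i‖ < 1) :
    ∃ F : (ι → Matrix.specialUnitaryGroup (Fin 2) ℂ) ≃ᵐ (ι → Matrix.specialUnitaryGroup (Fin 2) ℂ),
      (⇑F = fun (V : ι → Matrix.specialUnitaryGroup (Fin 2) ℂ) (i : ι) =>
        if p i then gaussUnit (geodesicKick ε (J V i)
          (vecQuat ((V i : Matrix.specialUnitaryGroup (Fin 2) ℂ) : Matrix (Fin 2) (Fin 2) ℂ)))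
        else V i) ∧
      HasJacobian (Measure.pi fun _ : ι => haarProbability (Matrix.specialUnitaryGroup (Fin 2) ℂ)) F
        (fun V => ENNReal.ofReal (∏ a : {i // p i},
          (if Real.sin (angle (J V a.1) (vecQuat ((V a.1 : Matrix.specialUnitaryGroup (Fin 2) ℂ) : Matrix (Fin 2) (Fin 2) ℂ))) = 0 then
              (1 - ε * ‖J V a.1‖ * Real.cos (angle (J V a.1) (vecQuat ((V a.1 : Matrix.specialUnitaryGroup (Fin 2) ℂ) : Matrix (Fin 2) (Fin 2) ℂ)))) ^ 3
            else kickJac (ε * ‖J V a.1‖) 2 (angle (J V a.1) (vecQuat ((V a.1 : Matrix.specialUnitaryGroup (Fin 2) ℂ) : Matrix (Fin 2) (Fin 2) ℂ)))))) ∧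
      (∀ V : ι → Matrix.specialUnitaryGroup (Fin 2) ℂ, 0 < ∏ a : {i // p i},
          (if Real.sin (angle (J V a.1) (vecQuat ((V a.1 : Matrix.specialUnitaryGroup (Fin 2) ℂ) : Matrix (Fin 2) (Fin 2) ℂ))) = 0 then
              (1 - ε * ‖J V a.1‖ * Real.cos (angle (J V a.1) (vecQuat ((V a.1 : Matrix.specialUnitaryGroup (Fin 2) ℂ) : Matrix (Fin 2) (Fin 2) ℂ)))) ^ 3
            else kickJac (ε * ‖J V a.1‖) 2 (angle (J V a.1) (vecQuat ((V a.1 : Matrix.specialUnitaryGroup (Fin 2) ℂ) : Matrix (Fin 2) (Fin 2) ℂ))))) ∧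
      Measurable fun V : ι → Matrix.specialUnitaryGroup (Fin 2) ℂ => ∏ a : {i // p i},
          (if Real.sin (angle (J V a.1) (vecQuat ((V a.1 : Matrix.specialUnitaryGroup (Fin 2) ℂ) : Matrix (Fin 2) (Fin 2) ℂ))) = 0 then
              (1 - ε * ‖J V a.1‖ * Real.cos (angle (J V a.1) (vecQuat ((V a.1 : Matrix.specialUnitaryGroup (Fin 2) ℂ) : Matrix (Fin 2) (Fin 2) ℂ)))) ^ 3
            else kickJac (ε * ‖J V a.1‖) 2 (angle (J V a.1) (vecQuat ((V a.1 : Matrix.specialUnitaryGroup (Fin 2) ℂ) : Matrix (Fin 2) (Fin 2) ℂ)))) := by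
  haveI : PolishSpace (Matrix.specialUnitaryGroup (Fin 2) ℂ) := polishSpace_SU2
  obtain ⟨hmeas, hbij, hJ, hpos, hJm'⟩ := su2MaskedKick_certified p J hJm hJloc hκ
  obtain ⟨F, hF⟩ := exists_measurableEquiv_of_bijective hmeas hbij
  refine ⟨F, hF, ?_, hpos, hJm'⟩
  rw [hF]
  exact hJ

end Certified

/-! ## FT-HMC through a masked kick layer on the gauge field, exactly as the engine runs it -/

section Member

variable {d L : ℕ} [NeZero L] (p : Edge d L → Prop) [DecidablePred p]

/-- **FT-HMC as the engine runs it on the `SU(2)` rung, through ANY masked kick layer driven by a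
frozen measurable local field inside its refusal rule, is exact.**  Momenta `(Edge × Fin 3) → ℝ`
with Lebesgue measure, `T = Σ p²/2`, Gaussian refresh; leapfrog with the closed-form quaternion
exponential drift and ANY measurable force `g`, any `n`; flip; Metropolis on
`(S ∘ F − log ∏ j̃) + T`; forget; report `F V`.  For every measurable action `S` the configuration
kernel leaves `e^{−S} · ⊗_e haarProbability SU(2)` invariant. -/
theorem su2_fthmc_leapfrog_gaussian_exact_maskedKick {ε : ℝ}
    (J : GaugeConfig d L (Matrix.specialUnitaryGroup (Fin 2) ℂ) → Edge d L → R4)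
    (hJm : ∀ e, p e → Measurable fun V : GaugeConfig d L (Matrix.specialUnitaryGroup (Fin 2) ℂ) => J V e)
    (hJloc : ∀ V W : GaugeConfig d L (Matrix.specialUnitaryGroup (Fin 2) ℂ),
      (∀ j, ¬p j → V j = W j) → ∀ e, p e → J V e = J W e)
    (hκ : ∀ (V : GaugeConfig d L (Matrix.specialUnitaryGroup (Fin 2) ℂ)) (e : Edge d L), p e → |ε| * ‖J V e‖ < 1)
    {S : GaugeConfig d L (Matrix.specialUnitaryGroup (Fin 2) ℂ) → ℝ} (hS : Measurable S) (c : ℝ)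
    {g : GaugeConfig d L (Matrix.specialUnitaryGroup (Fin 2) ℂ) → ((Edge d L × Fin 3) → ℝ)} (hg : Measurable g) (n : ℕ) :
    ∃ F : GaugeConfig d L (Matrix.specialUnitaryGroup (Fin 2) ℂ) ≃ᵐ GaugeConfig d L (Matrix.specialUnitaryGroup (Fin 2) ℂ),
      (⇑F = fun (V : GaugeConfig d L (Matrix.specialUnitaryGroup (Fin 2) ℂ)) (e : Edge d L) =>
        if p e then gaussUnit (geodesicKick ε (J V e)
          (vecQuat ((V e : Matrix.specialUnitaryGroup (Fin 2) ℂ) : Matrix (Fin 2) (Fin 2) ℂ)))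
        else V e) ∧
      Invariant
        (conjKernel
          (refreshUpdate
            (involMH
              (⇑((flip : Equiv.Perm (GaugeConfig d L (Matrix.specialUnitaryGroup (Fin 2) ℂ) × ((Edge d L × Fin 3) → ℝ))) *
                  leapfrog (mulDrift fun q : (Edge d L × Fin 3) → ℝ =>
                    fun ℓ : Edge d L => gaussUnit (toLp 2
          ![Real.cos (c * Real.sqrt (q (ℓ, 0) ^ 2 + q (ℓ, 1) ^ 2 + q (ℓ, 2) ^ 2)),
            c * Real.sinc (c * Real.sqrt (q (ℓ, 0) ^ 2 + q (ℓ, 1) ^ 2 + q (ℓ, 2) ^ 2)) * q (ℓ, 0),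
            c * Real.sinc (c * Real.sqrt (q (ℓ, 0) ^ 2 + q (ℓ, 1) ^ 2 + q (ℓ, 2) ^ 2)) * q (ℓ, 1),
            c * Real.sinc (c * Real.sqrt (q (ℓ, 0) ^ 2 + q (ℓ, 1) ^ 2 + q (ℓ, 2) ^ 2)) * q (ℓ, 2)])) g ^ n))
              (measurable_flip_leapfrog_pow (measurable_mulDrift (measurable_su2Drift c)) hg n)
              fun z : GaugeConfig d L (Matrix.specialUnitaryGroup (Fin 2) ℂ) × ((Edge d L × Fin 3) → ℝ) =>
                (S (F z.1) - Real.log (∏ a : {e : Edge d L // p e},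
                  (if Real.sin (angle (J z.1 a.1) (vecQuat ((z.1 a.1 : Matrix.specialUnitaryGroup (Fin 2) ℂ) : Matrix (Fin 2) (Fin 2) ℂ))) = 0 then
                      (1 - ε * ‖J z.1 a.1‖ * Real.cos (angle (J z.1 a.1) (vecQuat ((z.1 a.1 : Matrix.specialUnitaryGroup (Fin 2) ℂ) : Matrix (Fin 2) (Fin 2) ℂ)))) ^ 3
                    else kickJac (ε * ‖J z.1 a.1‖) 2 (angle (J z.1 a.1) (vecQuat ((z.1 a.1 : Matrix.specialUnitaryGroup (Fin 2) ℂ) : Matrix (Fin 2) (Fin 2) ℂ)))))) + ∑ i, z.2 i ^ 2 / 2)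
            ((((volume : Measure ((Edge d L × Fin 3) → ℝ)).withDensity
                  fun q => ENNReal.ofReal (Real.exp (-(∑ i, q i ^ 2 / 2)))) Set.univ)⁻¹ •
              (volume : Measure ((Edge d L × Fin 3) → ℝ)).withDensity
                fun q => ENNReal.ofReal (Real.exp (-(∑ i, q i ^ 2 / 2)))))
          F)
        ((Measure.pi fun _ : Edge d L => haarProbability (Matrix.specialUnitaryGroup (Fin 2) ℂ)).withDensity
          fun U => ENNReal.ofReal (Real.exp (-S U))) := by
  obtain ⟨F, hF, hJ, hpos, hJm'⟩ := exists_measurableEquiv_su2MaskedKick p J hJm hJloc hκ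
  haveI := isNegInvariant_volume_pi (Λ := Edge d L × Fin 3)
  refine ⟨F, hF, ?_⟩
  exact gauge_fthmc_leapfrog_config_exact
    (μ := Measure.pi fun _ : Edge d L => haarProbability (Matrix.specialUnitaryGroup (Fin 2) ℂ))
    (ν := (volume : Measure ((Edge d L × Fin 3) → ℝ))) (F := F)
    (e := fun q : (Edge d L × Fin 3) → ℝ => fun ℓ : Edge d L => gaussUnit (toLp 2
          ![Real.cos (c * Real.sqrt (q (ℓ, 0) ^ 2 + q (ℓ, 1) ^ 2 + q (ℓ, 2) ^ 2)),
            c * Real.sinc (c * Real.sqrt (q (ℓ, 0) ^ 2 + q (ℓ, 1) ^ 2 + q (ℓ, 2) ^ 2)) * q (ℓ, 0),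
            c * Real.sinc (c * Real.sqrt (q (ℓ, 0) ^ 2 + q (ℓ, 1) ^ 2 + q (ℓ, 2) ^ 2)) * q (ℓ, 1),
            c * Real.sinc (c * Real.sqrt (q (ℓ, 0) ^ 2 + q (ℓ, 1) ^ 2 + q (ℓ, 2) ^ 2)) * q (ℓ, 2)]))
    (g := g) (S := S) (T := fun q : (Edge d L × Fin 3) → ℝ => ∑ i, q i ^ 2 / 2)
    hpos hJm' hJ (fun q => su2Drift_neg c q) (measurable_su2Drift c) hg n hS
    measurable_piGaussianKinetic piGaussianWeight_univ_ne_zero_ne_top.1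
    piGaussianWeight_univ_ne_zero_ne_top.2

/-- **… and satisfies detailed balance** with respect to `e^{−S} · ⊗_e haarProbability SU(2)`
(the standing hypothesis of the cell's reversible-chain `τ_int` theorems). -/
theorem su2_fthmc_leapfrog_gaussian_isReversible_maskedKick {ε : ℝ}
    (J : GaugeConfig d L (Matrix.specialUnitaryGroup (Fin 2) ℂ) → Edge d L → R4)
    (hJm : ∀ e, p e → Measurable fun V : GaugeConfig d L (Matrix.specialUnitaryGroup (Fin 2) ℂ) => J V e)
    (hJloc : ∀ V W : GaugeConfig d L (Matrix.specialUnitaryGroup (Fin 2) ℂ),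
      (∀ j, ¬p j → V j = W j) → ∀ e, p e → J V e = J W e)
    (hκ : ∀ (V : GaugeConfig d L (Matrix.specialUnitaryGroup (Fin 2) ℂ)) (e : Edge d L), p e → |ε| * ‖J V e‖ < 1)
    {S : GaugeConfig d L (Matrix.specialUnitaryGroup (Fin 2) ℂ) → ℝ} (hS : Measurable S) (c : ℝ)
    {g : GaugeConfig d L (Matrix.specialUnitaryGroup (Fin 2) ℂ) → ((Edge d L × Fin 3) → ℝ)} (hg : Measurable g) (n : ℕ) :
    ∃ F : GaugeConfig d L (Matrix.specialUnitaryGroup (Fin 2) ℂ) ≃ᵐ GaugeConfig d L (Matrix.specialUnitaryGroup (Fin 2) ℂ),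
      (⇑F = fun (V : GaugeConfig d L (Matrix.specialUnitaryGroup (Fin 2) ℂ)) (e : Edge d L) =>
        if p e then gaussUnit (geodesicKick ε (J V e)
          (vecQuat ((V e : Matrix.specialUnitaryGroup (Fin 2) ℂ) : Matrix (Fin 2) (Fin 2) ℂ)))
        else V e) ∧
      IsReversible
        (conjKernel
          (refreshUpdate
            (involMH
              (⇑((flip : Equiv.Perm (GaugeConfig d L (Matrix.specialUnitaryGroup (Fin 2) ℂ) × ((Edge d L × Fin 3) → ℝ))) *
                  leapfrog (mulDrift fun q : (Edge d L × Fin 3) → ℝ =>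
                    fun ℓ : Edge d L => gaussUnit (toLp 2
          ![Real.cos (c * Real.sqrt (q (ℓ, 0) ^ 2 + q (ℓ, 1) ^ 2 + q (ℓ, 2) ^ 2)),
            c * Real.sinc (c * Real.sqrt (q (ℓ, 0) ^ 2 + q (ℓ, 1) ^ 2 + q (ℓ, 2) ^ 2)) * q (ℓ, 0),
            c * Real.sinc (c * Real.sqrt (q (ℓ, 0) ^ 2 + q (ℓ, 1) ^ 2 + q (ℓ, 2) ^ 2)) * q (ℓ, 1),
            c * Real.sinc (c * Real.sqrt (q (ℓ, 0) ^ 2 + q (ℓ, 1) ^ 2 + q (ℓ, 2) ^ 2)) * q (ℓ, 2)])) g ^ n))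
              (measurable_flip_leapfrog_pow (measurable_mulDrift (measurable_su2Drift c)) hg n)
              fun z : GaugeConfig d L (Matrix.specialUnitaryGroup (Fin 2) ℂ) × ((Edge d L × Fin 3) → ℝ) =>
                (S (F z.1) - Real.log (∏ a : {e : Edge d L // p e},
                  (if Real.sin (angle (J z.1 a.1) (vecQuat ((z.1 a.1 : Matrix.specialUnitaryGroup (Fin 2) ℂ) : Matrix (Fin 2) (Fin 2) ℂ))) = 0 then
                      (1 - ε * ‖J z.1 a.1‖ * Real.cos (angle (J z.1 a.1) (vecQuat ((z.1 a.1 : Matrix.specialUnitaryGroup (Fin 2) ℂ) : Matrix (Fin 2) (Fin 2) ℂ)))) ^ 3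
                    else kickJac (ε * ‖J z.1 a.1‖) 2 (angle (J z.1 a.1) (vecQuat ((z.1 a.1 : Matrix.specialUnitaryGroup (Fin 2) ℂ) : Matrix (Fin 2) (Fin 2) ℂ)))))) + ∑ i, z.2 i ^ 2 / 2)
            ((((volume : Measure ((Edge d L × Fin 3) → ℝ)).withDensity
                  fun q => ENNReal.ofReal (Real.exp (-(∑ i, q i ^ 2 / 2)))) Set.univ)⁻¹ •
              (volume : Measure ((Edge d L × Fin 3) → ℝ)).withDensity
                fun q => ENNReal.ofReal (Real.exp (-(∑ i, q i ^ 2 / 2)))))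
          F)
        ((Measure.pi fun _ : Edge d L => haarProbability (Matrix.specialUnitaryGroup (Fin 2) ℂ)).withDensity
          fun U => ENNReal.ofReal (Real.exp (-S U))) := by
  obtain ⟨F, hF, hJ, hpos, hJm'⟩ := exists_measurableEquiv_su2MaskedKick p J hJm hJloc hκ
  haveI := isNegInvariant_volume_pi (Λ := Edge d L × Fin 3)
  refine ⟨F, hF, ?_⟩
  exact gauge_fthmc_leapfrog_config_isReversible
    (μ := Measure.pi fun _ : Edge d L => haarProbability (Matrix.specialUnitaryGroup (Fin 2) ℂ))
    (ν := (volume : Measure ((Edge d L × Fin 3) → ℝ))) (F := F)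
    (e := fun q : (Edge d L × Fin 3) → ℝ => fun ℓ : Edge d L => gaussUnit (toLp 2
          ![Real.cos (c * Real.sqrt (q (ℓ, 0) ^ 2 + q (ℓ, 1) ^ 2 + q (ℓ, 2) ^ 2)),
            c * Real.sinc (c * Real.sqrt (q (ℓ, 0) ^ 2 + q (ℓ, 1) ^ 2 + q (ℓ, 2) ^ 2)) * q (ℓ, 0),
            c * Real.sinc (c * Real.sqrt (q (ℓ, 0) ^ 2 + q (ℓ, 1) ^ 2 + q (ℓ, 2) ^ 2)) * q (ℓ, 1),
            c * Real.sinc (c * Real.sqrt (q (ℓ, 0) ^ 2 + q (ℓ, 1) ^ 2 + q (ℓ, 2) ^ 2)) * q (ℓ, 2)]))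
    (g := g) (S := S) (T := fun q : (Edge d L × Fin 3) → ℝ => ∑ i, q i ^ 2 / 2)
    hpos hJm' hJ (fun q => su2Drift_neg c q) (measurable_su2Drift c) hg n hS
    measurable_piGaussianKinetic

end Member

end Summit.Ventures.LatticeQCDFlow.Exactness
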